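import Mathlib
import Summits.NavierStokesRegularity.NavierStokesRegularity.Theorems.EulerZoomLiouvillePowerGaugeEulerLiouvilleWindowFlux
import Literature.Analysis.FluidPDE.SuitableWeak
import HarnessLib

/-!
# Crux `EulerZoomLiouville.PowerGaugeEulerLiouville` (stmt-NavierStokesRegularity-19832), line `pressure-floor`, stub A1 — part 1:
# THE TIDAL WEIGHT `(1+|x|)^{-3}` IS INTEGRABLE AGAINST `|u|²` AND `|p|` ON FINITE PAST WINDOWS (gauge-tail summation)

Route №10 `EulerZoomLiouville` (NavierStokesRegularity), crux E.  Line `pressure-floor` (ideator ns-idea-11;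
`Cruxes/PowerGaugeEulerLiouville/Lines/pressure_floor.lean`), registered stub `stub_weightedVirial` (A1, «gauge-tail summation»):
the slicewise weighted virial identity of a member of Seregin's power-gauged class against every Newtonian weight.  The tree's
Chae identity (`IsDistributionalNSSolutionOn.ae_integral_hessian_apply_add_integral_pressure_mul_laplacian_eq_zero`) needs six
integrability hypotheses on the window `(α,β) × ℝ³`; all six are dominated by the two WEIGHTED MASSES
`∫∫_{(α,β)×ℝ³} |u|² (1+|x|)^{-3}` and `∫∫_{(α,β)×ℝ³} |p| (1+|x|)^{-3}`, which this file bounds from the `A`- and `D`-gauges: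

* `inv_one_add_norm_cube_le_tsum` — `(1+|x|)^{-3} ≤ Σ_k 8·8^{-k}·1_{B(0, a₀2^{k+1})}(x)` for `a₀ ≥ 1`;
* `lintegral_weight3_le_tsum` — hence `∫_{I×E} F (1+|x|)^{-3} ≤ Σ_k 8·8^{-k} ∫_{I×B(0,a₀2^{k+1})} F` for every density `F`;
* `slice_ball_le_of_gaugeA`, `lintegral_sq_window_ball_le_of_gaugeA` — slice `A`-gauge and `∫∫_{(α,β)×B(R)} |u|² ≤ (β−α)·c R^{1−2ρ}` (`R² ≥ −α`, `β ≤ 0`; slice `A`-gauge + Tonelli; trivial if `β ≤ α`);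
* `lintegral_pressure_window_ball_le_of_gaugeD` — `∫∫_{(α,β)×B(R)} |p| ≤ (c R^{2−2ρ})^{2/3} ((β−α)|B₁|R³)^{1/3}` (Hölder + `D`-gauge);
* **`lintegral_sq_weight3_lt_top`, `lintegral_pressure_weight3_lt_top`** — the two weighted masses are finite on every
  window `(α,β)`, `α < β ≤ 0`, for every `ρ ≥ 0` (geometric series with ratios `2^{−2−2ρ}`, `2^{−(2+4ρ)/3}`).

WHAT THIS IS NOT: not NS, not the crux — helper bookkeeping `--supports` stmt-19832 on the line `pressure-floor`; no summit
statement is proved here.  [cite: CaffarelliKohnNirenberg1982, §2 (the scaled quantities A, D); Chae2008Weighted, Thm 1.1 (the weight class)]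
-/

noncomputable section

-- flat `Theorems/<Route><Decl>…` files of one crux share the namespace of the crux (tree convention)
set_option linter.dupNamespace false

open MeasureTheory Set Filter Topology Metric Function
open scoped NNReal ENNReal

namespace Summit.NavierStokesRegularity.NavierStokesRegularity.Theorems.PowerGaugeEulerLiouville.PressureFloor

open Literature.Analysis Literature.Analysis.FluidPDE

variable {u : ℝ → EuclideanSpace ℝ (Fin 3) → EuclideanSpace ℝ (Fin 3)} {p : ℝ → EuclideanSpace ℝ (Fin 3) → ℝ}

/-! ### The tidal weight against dyadic balls -/

/-- **The tidal weight is dominated by a geometric sum of dyadic-ball indicators**: for `a₀ ≥ 1`,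
`(1+|x|)^{-3} ≤ Σ_{k≥0} 8·8^{−k}·1_{B(0, a₀ 2^{k+1})}(x)` (one term suffices: `k = 0` if `|x| < a₀`, else the `k` with
`a₀2^k ≤ |x| < a₀2^{k+1}`, where `(1+|x|)^{-3} ≤ |x|^{-3} ≤ (a₀2^k)^{-3} ≤ 8^{-k}`). [folklore] -/
theorem inv_one_add_norm_cube_le_tsum {a₀ : ℝ} (ha₀ : 1 ≤ a₀) (x : EuclideanSpace ℝ (Fin 3)) :
    ENNReal.ofReal (((1 + ‖x‖) ^ 3)⁻¹) ≤
      ∑' k : ℕ, (ball (0 : EuclideanSpace ℝ (Fin 3)) (a₀ * (2 : ℝ) ^ (k + 1))).indicator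
        (fun _ => (8 : ℝ≥0∞) * (8⁻¹ : ℝ≥0∞) ^ k) x := by
  have ha₀0 : 0 < a₀ := by linarith
  obtain ⟨j, hjmem, hjle⟩ : ∃ j : ℕ, x ∈ ball (0 : EuclideanSpace ℝ (Fin 3)) (a₀ * (2 : ℝ) ^ (j + 1)) ∧
      ((1 + ‖x‖) ^ 3)⁻¹ ≤ 8 * (8⁻¹ : ℝ) ^ j := by
    by_cases hx : ‖x‖ < a₀
    · refine ⟨0, mem_ball_zero_iff.2 (by norm_num; linarith), ?_⟩
      have h1 : 1 ≤ (1 + ‖x‖) ^ 3 := one_le_pow₀ (by linarith [norm_nonneg x])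
      calc ((1 + ‖x‖) ^ 3)⁻¹ ≤ 1 := inv_le_one_of_one_le₀ h1
        _ ≤ 8 * (8⁻¹ : ℝ) ^ 0 := by norm_num
    · rw [not_lt] at hx
      have hx1 : 1 ≤ ‖x‖ / a₀ := by rw [le_div_iff₀ ha₀0]; linarith
      obtain ⟨j, hj1, hj2⟩ := exists_nat_pow_near hx1 one_lt_two
      refine ⟨j, mem_ball_zero_iff.2 ?_, ?_⟩
      · rw [div_lt_iff₀ ha₀0] at hj2; linarith
      · rw [le_div_iff₀ ha₀0] at hj1
        have hpos : (0 : ℝ) < 2 ^ j := by positivity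
        have hxpos : 0 < ‖x‖ := by linarith
        have h2j : (2 : ℝ) ^ j ≤ ‖x‖ := le_trans (by nlinarith) hj1
        calc ((1 + ‖x‖) ^ 3)⁻¹ ≤ (‖x‖ ^ 3)⁻¹ := by
              apply inv_anti₀ (by positivity)
              exact pow_le_pow_left₀ hxpos.le (by linarith) 3
          _ ≤ (((2 : ℝ) ^ j) ^ 3)⁻¹ := by
              apply inv_anti₀ (by positivity)
              exact pow_le_pow_left₀ hpos.le h2j 3
          _ = (8⁻¹ : ℝ) ^ j := by
              rw [← pow_mul', pow_mul, ← inv_pow]; norm_num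
          _ ≤ 8 * (8⁻¹ : ℝ) ^ j := by nlinarith [pow_pos (by norm_num : (0 : ℝ) < 8⁻¹) j]
  calc ENNReal.ofReal (((1 + ‖x‖) ^ 3)⁻¹) ≤ ENNReal.ofReal (8 * (8⁻¹ : ℝ) ^ j) := ENNReal.ofReal_le_ofReal hjle
    _ = (ball (0 : EuclideanSpace ℝ (Fin 3)) (a₀ * (2 : ℝ) ^ (j + 1))).indicator
          (fun _ => (8 : ℝ≥0∞) * (8⁻¹ : ℝ≥0∞) ^ j) x := by
        rw [indicator_of_mem hjmem, ENNReal.ofReal_mul (by norm_num), ENNReal.ofReal_pow (by norm_num),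
          ENNReal.ofReal_inv_of_pos (by norm_num)]
        norm_num
    _ ≤ _ := ENNReal.le_tsum j

/-- **Weighted space–time integrals against dyadic balls**: for a density `F ≥ 0` on `I × ℝ³` and `a₀ ≥ 1`,
`∫_{I×ℝ³} F(z) (1+|z.2|)^{-3} ≤ Σ_k 8·8^{−k} ∫_{I×B(0,a₀2^{k+1})} F`. [folklore] -/
theorem lintegral_weight3_le_tsum {I : Set ℝ} {F : ℝ × EuclideanSpace ℝ (Fin 3) → ℝ≥0∞}
    (hF : AEMeasurable F (volume.restrict (I ×ˢ (univ : Set (EuclideanSpace ℝ (Fin 3)))))) {a₀ : ℝ} (ha₀ : 1 ≤ a₀) :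
    ∫⁻ z in I ×ˢ (univ : Set (EuclideanSpace ℝ (Fin 3))), F z * ENNReal.ofReal (((1 + ‖z.2‖) ^ 3)⁻¹) ≤
      ∑' k : ℕ, (8 : ℝ≥0∞) * (8⁻¹ : ℝ≥0∞) ^ k *
        ∫⁻ z in I ×ˢ ball (0 : EuclideanSpace ℝ (Fin 3)) (a₀ * (2 : ℝ) ^ (k + 1)), F z := by
  -- adapted from `WindowFlux.lintegral_weight_le_tsum` (same crux, weight `1/max(1,|x|)`)
  set B : ℕ → Set (EuclideanSpace ℝ (Fin 3)) := fun k => ball (0 : EuclideanSpace ℝ (Fin 3)) (a₀ * (2 : ℝ) ^ (k + 1)) with hB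
  have hpt : ∀ z : ℝ × EuclideanSpace ℝ (Fin 3), F z * ENNReal.ofReal (((1 + ‖z.2‖) ^ 3)⁻¹) ≤
      ∑' k : ℕ, F z * (B k).indicator (fun _ => (8 : ℝ≥0∞) * (8⁻¹ : ℝ≥0∞) ^ k) z.2 := by
    intro z
    rw [ENNReal.tsum_mul_left]
    exact mul_le_mul' le_rfl (inv_one_add_norm_cube_le_tsum ha₀ z.2)
  have hmeas : ∀ k : ℕ, AEMeasurable (fun z : ℝ × EuclideanSpace ℝ (Fin 3) =>
      F z * (B k).indicator (fun _ => (8 : ℝ≥0∞) * (8⁻¹ : ℝ≥0∞) ^ k) z.2)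
      (volume.restrict (I ×ˢ (univ : Set (EuclideanSpace ℝ (Fin 3))))) := fun k =>
    hF.mul ((measurable_const.indicator measurableSet_ball).comp measurable_snd).aemeasurable
  calc ∫⁻ z in I ×ˢ (univ : Set (EuclideanSpace ℝ (Fin 3))), F z * ENNReal.ofReal (((1 + ‖z.2‖) ^ 3)⁻¹)
      ≤ ∫⁻ z in I ×ˢ (univ : Set (EuclideanSpace ℝ (Fin 3))), ∑' k : ℕ,
          F z * (B k).indicator (fun _ => (8 : ℝ≥0∞) * (8⁻¹ : ℝ≥0∞) ^ k) z.2 := lintegral_mono hpt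
    _ = ∑' k : ℕ, ∫⁻ z in I ×ˢ (univ : Set (EuclideanSpace ℝ (Fin 3))),
          F z * (B k).indicator (fun _ => (8 : ℝ≥0∞) * (8⁻¹ : ℝ≥0∞) ^ k) z.2 := lintegral_tsum hmeas
    _ = ∑' k : ℕ, (8 : ℝ≥0∞) * (8⁻¹ : ℝ≥0∞) ^ k * ∫⁻ z in I ×ˢ B k, F z := by
        refine tsum_congr fun k => ?_
        have hind : ∀ z : ℝ × EuclideanSpace ℝ (Fin 3),
            F z * (B k).indicator (fun _ => (8 : ℝ≥0∞) * (8⁻¹ : ℝ≥0∞) ^ k) z.2 =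
            ((univ : Set ℝ) ×ˢ B k).indicator (fun z => (8 : ℝ≥0∞) * (8⁻¹ : ℝ≥0∞) ^ k * F z) z := by
          intro z
          by_cases hz : z.2 ∈ B k
          · rw [indicator_of_mem hz, indicator_of_mem (mem_prod.2 ⟨mem_univ _, hz⟩), mul_comm]
          · rw [indicator_of_notMem hz, indicator_of_notMem (fun h => hz (mem_prod.1 h).2), mul_zero]
        simp_rw [hind]
        have hset : ((univ : Set ℝ) ×ˢ B k) ∩ (I ×ˢ (univ : Set (EuclideanSpace ℝ (Fin 3)))) = I ×ˢ B k := by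
          rw [Set.prod_inter_prod, univ_inter, inter_univ]
        rw [lintegral_indicator (MeasurableSet.univ.prod measurableSet_ball), Measure.restrict_restrict
          (MeasurableSet.univ.prod measurableSet_ball), hset, lintegral_const_mul' _ _ (by
            exact ENNReal.mul_ne_top (by norm_num) (ENNReal.pow_ne_top (by norm_num)))]

/-! ### The one-ball window masses from the gauges -/

/-- **The `A`-gauge bounds every slice in its window**: if `a^{2ρ} A(u; Q_a(0)) ≤ c`, `a > 0` and `−a² < τ < 0`, then
`∫_{B_a} |u(τ)|² ≤ c · a^{1−2ρ}`. [folklore] -/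
theorem slice_ball_le_of_gaugeA {ρ : ℝ} {c : ℝ≥0} {a τ : ℝ} (ha : 0 < a) (hτa : -(a ^ 2) < τ) (hτ : τ < 0)
    (hA : ENNReal.ofReal (a ^ (2 * ρ)) * cknA a (0 : ℝ × EuclideanSpace ℝ (Fin 3)) u ≤ (c : ℝ≥0∞)) :
    ∫⁻ x in ball (0 : EuclideanSpace ℝ (Fin 3)) a, ‖u τ x‖ₑ ^ 2 ≤ ENNReal.ofReal ((c : ℝ) * a ^ (1 - 2 * ρ)) := by
  -- adapted from `SpacePeriodic.slice_ball_le_of_gaugeA` (same crux; not imported to stay outside the Theses cone)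
  set I : ℝ≥0∞ := ∫⁻ x in ball (0 : EuclideanSpace ℝ (Fin 3)) a, ‖u τ x‖ₑ ^ 2 with hI
  have hslice : (ENNReal.ofReal a)⁻¹ * I ≤ cknA a (0 : ℝ × EuclideanSpace ℝ (Fin 3)) u := by
    unfold cknA
    have hs : τ ∈ Ioo ((0 : ℝ × EuclideanSpace ℝ (Fin 3)).1 - a ^ 2) (0 : ℝ × EuclideanSpace ℝ (Fin 3)).1 := by
      simp only [Prod.fst_zero, zero_sub, mem_Ioo]
      exact ⟨hτa, hτ⟩
    exact le_iSup₂ (f := fun t (_ : t ∈ Ioo ((0 : ℝ × EuclideanSpace ℝ (Fin 3)).1 - a ^ 2)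
        (0 : ℝ × EuclideanSpace ℝ (Fin 3)).1) =>
        (ENNReal.ofReal a)⁻¹ * ∫⁻ x in ball (0 : ℝ × EuclideanSpace ℝ (Fin 3)).2 a, ‖u t x‖ₑ ^ 2) τ hs
  have h1 : ENNReal.ofReal (a ^ (2 * ρ)) * ((ENNReal.ofReal a)⁻¹ * I) ≤ (c : ℝ≥0∞) :=
    le_trans (mul_le_mul' le_rfl hslice) hA
  have h2 : ENNReal.ofReal (a ^ (2 * ρ)) * (ENNReal.ofReal a)⁻¹ = ENNReal.ofReal (a ^ (2 * ρ - 1)) := by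
    rw [← ENNReal.ofReal_inv_of_pos ha, ← ENNReal.ofReal_mul (Real.rpow_nonneg ha.le _)]
    congr 1
    rw [Real.rpow_sub ha, Real.rpow_one, div_eq_mul_inv]
  rw [← mul_assoc, h2] at h1
  have hpos : 0 < a ^ (2 * ρ - 1) := Real.rpow_pos_of_pos ha _
  have h3 : I ≤ (c : ℝ≥0∞) / ENNReal.ofReal (a ^ (2 * ρ - 1)) := by
    rw [ENNReal.le_div_iff_mul_le (Or.inl (ENNReal.ofReal_pos.2 hpos).ne') (Or.inl ENNReal.ofReal_ne_top),
      mul_comm]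
    exact h1
  refine h3.trans (le_of_eq ?_)
  rw [← ENNReal.ofReal_coe_nnreal, ← ENNReal.ofReal_div_of_pos hpos]
  congr 1
  rw [div_eq_mul_inv, ← Real.rpow_neg ha.le, neg_sub]

/-- **Velocity window mass from the `A`-gauge**: `∫∫_{(α,β)×B(R)} |u|² ≤ (β−α)·c R^{1−2ρ}` whenever `−R² ≤ α`, `β ≤ 0`
(the slice bound `∫_{B_R}|u(t)|² ≤ c R^{1−2ρ}` for `−R² < t < 0`, integrated in `t`; Tonelli as an inequality). [folklore] -/
theorem lintegral_sq_window_ball_le_of_gaugeA {ρ : ℝ} {c : ℝ≥0}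
    (hA : ∀ a : ℝ, 0 < a → ENNReal.ofReal (a ^ (2 * ρ)) * cknA a (0 : ℝ × EuclideanSpace ℝ (Fin 3)) u ≤ (c : ℝ≥0∞))
    {R α β : ℝ} (hR : 0 < R) (hα : -(R ^ 2) ≤ α) (hβ : β ≤ 0) :
    ∫⁻ z in Ioo α β ×ˢ ball (0 : EuclideanSpace ℝ (Fin 3)) R, ‖u z.1 z.2‖ₑ ^ 2 ≤
      ENNReal.ofReal ((β - α) * ((c : ℝ) * R ^ (1 - 2 * ρ))) := by
  have hμ : (volume : Measure (ℝ × EuclideanSpace ℝ (Fin 3))).restrict (Ioo α β ×ˢ ball (0 : EuclideanSpace ℝ (Fin 3)) R) =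
      ((volume : Measure ℝ).restrict (Ioo α β)).prod
        ((volume : Measure (EuclideanSpace ℝ (Fin 3))).restrict (ball (0 : EuclideanSpace ℝ (Fin 3)) R)) := by
    rw [Measure.prod_restrict, ← Measure.volume_eq_prod]
  rw [hμ]
  refine (lintegral_prod_le _).trans ?_
  have hslice : ∀ t ∈ Ioo α β, ∫⁻ x in ball (0 : EuclideanSpace ℝ (Fin 3)) R, ‖u t x‖ₑ ^ 2 ≤
      ENNReal.ofReal ((c : ℝ) * R ^ (1 - 2 * ρ)) := fun t ht =>
    slice_ball_le_of_gaugeA hR (lt_of_le_of_lt hα ht.1) (lt_of_lt_of_le ht.2 hβ) (hA R hR)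
  calc ∫⁻ t in Ioo α β, ∫⁻ x in ball (0 : EuclideanSpace ℝ (Fin 3)) R, ‖u (t, x).1 (t, x).2‖ₑ ^ 2
      ≤ ∫⁻ _ in Ioo α β, ENNReal.ofReal ((c : ℝ) * R ^ (1 - 2 * ρ)) := setLIntegral_mono' measurableSet_Ioo hslice
    _ = ENNReal.ofReal ((β - α) * ((c : ℝ) * R ^ (1 - 2 * ρ))) := by
        rw [setLIntegral_const, Real.volume_Ioo, ← ENNReal.ofReal_mul (by positivity)]
        congr 1
        ring

/-- **Pressure window mass from the `D`-gauge**: `∫∫_{(α,β)×B(R)} |p| ≤ (c R^{2−2ρ})^{2/3} · ((β−α)·|B(0,R)|)^{1/3}` whenever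
`−R² ≤ α < β ≤ 0` (Hölder `(3/2, 3)` against `1`, `∫∫_{Q_R}|p|^{3/2} = R² D(R) ≤ c R^{2−2ρ}`). [folklore] -/
theorem lintegral_pressure_window_ball_le_of_gaugeD {ρ : ℝ} {c : ℝ≥0}
    (hpm : AEStronglyMeasurable (uncurry p) (volume.restrict (Iio (0 : ℝ) ×ˢ (univ : Set (EuclideanSpace ℝ (Fin 3))))))
    (hD : ∀ a : ℝ, 0 < a → ENNReal.ofReal (a ^ (2 * ρ)) * cknD a (0 : ℝ × EuclideanSpace ℝ (Fin 3)) p ≤ (c : ℝ≥0∞))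
    {R α β : ℝ} (hR : 0 < R) (hα : -(R ^ 2) ≤ α) (hβ : β ≤ 0) :
    ∫⁻ z in Ioo α β ×ˢ ball (0 : EuclideanSpace ℝ (Fin 3)) R, ‖p z.1 z.2‖ₑ ≤
      ENNReal.ofReal ((c : ℝ) * R ^ (2 - 2 * ρ)) ^ (2 / 3 : ℝ) *
        (volume (Ioo α β ×ˢ ball (0 : EuclideanSpace ℝ (Fin 3)) R)) ^ (1 / 3 : ℝ) := by
  -- adapted from `lintegral_pressure_velocity_window_le` (…WindowFluxBounds, same crux) with `u` replaced by `1`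
  set S : Set (ℝ × EuclideanSpace ℝ (Fin 3)) := Ioo α β ×ˢ ball (0 : EuclideanSpace ℝ (Fin 3)) R with hS
  have hSsub : S ⊆ Iio (0 : ℝ) ×ˢ (univ : Set (EuclideanSpace ℝ (Fin 3))) :=
    prod_mono (fun s hs => lt_of_lt_of_le hs.2 hβ) (subset_univ _)
  have hSQ : S ⊆ parabolicCylinder R (0 : ℝ × EuclideanSpace ℝ (Fin 3)) := by
    intro z hz
    simp only [parabolicCylinder, mem_prod, mem_Ioo, mem_ball, Prod.fst_zero, Prod.snd_zero, zero_sub] at hz ⊢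
    exact ⟨⟨lt_of_le_of_lt hα hz.1.1, lt_of_lt_of_le hz.1.2 hβ⟩, mem_ball.1 hz.2⟩
  have hp' : AEMeasurable (fun z : ℝ × EuclideanSpace ℝ (Fin 3) => ‖p z.1 z.2‖ₑ) (volume.restrict S) :=
    (hpm.mono_measure (Measure.restrict_mono hSsub le_rfl)).aemeasurable.enorm
  have hpq : (3 / 2 : ℝ).HolderConjugate 3 := Real.holderConjugate_iff.2 ⟨by norm_num, by norm_num⟩
  have hH := ENNReal.lintegral_mul_le_Lp_mul_Lq (volume.restrict S) hpq hp' aemeasurable_const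
    (g := fun _ => (1 : ℝ≥0∞))
  simp only [Pi.mul_apply, mul_one, ENNReal.one_rpow, lintegral_const, Measure.restrict_apply MeasurableSet.univ,
    univ_inter, one_mul] at hH
  refine hH.trans ?_
  rw [show (1 / (3 / 2 : ℝ)) = (2 / 3 : ℝ) by norm_num]
  refine mul_le_mul' (ENNReal.rpow_le_rpow ?_ (by norm_num)) le_rfl
  -- `∫_S |p|^{3/2} ≤ c R^{2-2ρ}`
  have h1 := hD R hR
  have hJ : ∫⁻ q in parabolicCylinder R (0 : ℝ × EuclideanSpace ℝ (Fin 3)), ‖p q.1 q.2‖ₑ ^ (3 / 2 : ℝ) ≤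
      ENNReal.ofReal ((c : ℝ) * R ^ (2 - 2 * ρ)) := by
    have hpos : 0 < R ^ (2 * ρ) * (R ^ 2)⁻¹ := by positivity
    have hcoef : ENNReal.ofReal (R ^ (2 * ρ)) * (ENNReal.ofReal R ^ 2)⁻¹ = ENNReal.ofReal (R ^ (2 * ρ) * (R ^ 2)⁻¹) := by
      rw [← ENNReal.ofReal_pow hR.le, ← ENNReal.ofReal_inv_of_pos (by positivity),
        ← ENNReal.ofReal_mul (Real.rpow_nonneg hR.le _)]
    unfold cknD at h1
    rw [← mul_assoc, hcoef] at h1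
    have h2 : ∫⁻ q in parabolicCylinder R (0 : ℝ × EuclideanSpace ℝ (Fin 3)), ‖p q.1 q.2‖ₑ ^ (3 / 2 : ℝ) ≤
        (c : ℝ≥0∞) / ENNReal.ofReal (R ^ (2 * ρ) * (R ^ 2)⁻¹) := by
      rw [ENNReal.le_div_iff_mul_le (Or.inl ((ENNReal.ofReal_pos.2 hpos).ne')) (Or.inl ENNReal.ofReal_ne_top),
        mul_comm]
      exact h1
    refine h2.trans (le_of_eq ?_)
    rw [ENNReal.coe_nnreal_eq, ← ENNReal.ofReal_div_of_pos hpos]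
    congr 1
    rw [div_eq_mul_inv, mul_inv, inv_inv, Real.rpow_sub hR, Real.rpow_two, div_eq_mul_inv]
    ring
  exact (lintegral_mono_set hSQ).trans hJ

/-! ### The weighted masses are finite on every window -/

/-- **The tidal weight is integrable against `|u|²` on every finite past window** (`α < β ≤ 0`, any `ρ ≥ 0`): with `a₀ = max(1, √(−α))`,
`∫∫_{(α,β)×ℝ³} |u|²(1+|x|)^{-3} ≤ Σ_k 8·8^{-k} (β−α) c (2a₀)^{1−2ρ} (2^{1−2ρ})^k < ∞` (ratio `2^{−2−2ρ} < 1`). [folklore] -/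
theorem lintegral_sq_weight3_lt_top {ρ : ℝ} (hρ : 0 ≤ ρ) {c : ℝ≥0}
    (hum : AEStronglyMeasurable (uncurry u) (volume.restrict (Iio (0 : ℝ) ×ˢ (univ : Set (EuclideanSpace ℝ (Fin 3))))))
    (hA : ∀ a : ℝ, 0 < a → ENNReal.ofReal (a ^ (2 * ρ)) * cknA a (0 : ℝ × EuclideanSpace ℝ (Fin 3)) u ≤ (c : ℝ≥0∞))
    {α β : ℝ} (hαβ : α < β) (hβ : β ≤ 0) :
    ∫⁻ z in Ioo α β ×ˢ (univ : Set (EuclideanSpace ℝ (Fin 3))),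
        ‖u z.1 z.2‖ₑ ^ 2 * ENNReal.ofReal (((1 + ‖z.2‖) ^ 3)⁻¹) < ⊤ := by
  -- dyadic radii `a₀ 2^{k+1}`, `a₀² ≥ -α`
  have hα0 : 0 ≤ -α := by linarith
  set a₀ : ℝ := max 1 (Real.sqrt (-α)) with ha₀
  have ha₀1 : 1 ≤ a₀ := le_max_left _ _
  have ha₀0 : 0 < a₀ := lt_of_lt_of_le one_pos ha₀1
  have ha₀α : -(a₀ ^ 2) ≤ α := by
    have h1 : Real.sqrt (-α) ≤ a₀ := le_max_right _ _
    have h2 : Real.sqrt (-α) ^ 2 = -α := Real.sq_sqrt hα0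
    nlinarith [Real.sqrt_nonneg (-α)]
  set R : ℕ → ℝ := fun k => a₀ * 2 ^ (k + 1) with hR
  have hR0 : ∀ k, 0 < R k := fun k => by positivity
  have hRα : ∀ k, -(R k ^ 2) ≤ α := fun k => by
    have : a₀ ^ 2 ≤ R k ^ 2 := by
      have h1 : a₀ ≤ R k := le_mul_of_one_le_right ha₀0.le (one_le_pow₀ (by norm_num))
      nlinarith
    linarith
  -- measurability of the density on the window
  have hWs : Ioo α β ⊆ Iio (0 : ℝ) := fun s hs => lt_of_lt_of_le hs.2 hβ
  have hF : AEMeasurable (fun z : ℝ × EuclideanSpace ℝ (Fin 3) => ‖u z.1 z.2‖ₑ ^ 2)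
      (volume.restrict (Ioo α β ×ˢ (univ : Set (EuclideanSpace ℝ (Fin 3))))) :=
    ((hum.mono_measure (Measure.restrict_mono (prod_mono hWs Subset.rfl) le_rfl)).aemeasurable.enorm.pow_const _)
  refine lt_of_le_of_lt (lintegral_weight3_le_tsum hF ha₀1) ?_
  -- the one-ball masses and the geometric series
  have hball : ∀ k : ℕ, ∫⁻ z in Ioo α β ×ˢ ball (0 : EuclideanSpace ℝ (Fin 3)) (a₀ * (2 : ℝ) ^ (k + 1)), ‖u z.1 z.2‖ₑ ^ 2 ≤
      ENNReal.ofReal ((β - α) * ((c : ℝ) * R k ^ (1 - 2 * ρ))) := fun k =>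
    lintegral_sq_window_ball_le_of_gaugeA hA (hR0 k) (hRα k) hβ
  set M : ℝ := 8 * ((β - α) * ((c : ℝ) * (2 * a₀) ^ (1 - 2 * ρ))) with hM
  have hM0 : 0 ≤ M := by positivity
  set θ : ℝ := 8⁻¹ * (2 : ℝ) ^ (1 - 2 * ρ) with hθ
  have hθ0 : 0 ≤ θ := by positivity
  have hθ1 : θ < 1 := by
    have h2 : (2 : ℝ) ^ (1 - 2 * ρ) ≤ 2 ^ (1 : ℝ) := Real.rpow_le_rpow_of_exponent_le one_le_two (by linarith)
    rw [Real.rpow_one] at h2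
    rw [hθ]; nlinarith
  have hterm : ∀ k : ℕ, (8 : ℝ≥0∞) * (8⁻¹ : ℝ≥0∞) ^ k *
      ∫⁻ z in Ioo α β ×ˢ ball (0 : EuclideanSpace ℝ (Fin 3)) (a₀ * (2 : ℝ) ^ (k + 1)), ‖u z.1 z.2‖ₑ ^ 2 ≤
      ENNReal.ofReal (M * θ ^ k + 0 * (0 : ℝ) ^ k) := by
    intro k
    have hRk : R k ^ (1 - 2 * ρ) = (2 * a₀) ^ (1 - 2 * ρ) * ((2 : ℝ) ^ (1 - 2 * ρ)) ^ k := by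
      simp only [hR]
      rw [pow_succ, show a₀ * (2 ^ k * 2) = (2 * a₀) * 2 ^ k by ring,
        Real.mul_rpow (by positivity) (by positivity), ← Real.rpow_natCast (2 : ℝ) k, ← Real.rpow_mul (by norm_num),
        mul_comm (k : ℝ), Real.rpow_mul (by norm_num), Real.rpow_natCast]
    calc (8 : ℝ≥0∞) * (8⁻¹ : ℝ≥0∞) ^ k *
          ∫⁻ z in Ioo α β ×ˢ ball (0 : EuclideanSpace ℝ (Fin 3)) (a₀ * (2 : ℝ) ^ (k + 1)), ‖u z.1 z.2‖ₑ ^ 2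
        ≤ (8 : ℝ≥0∞) * (8⁻¹ : ℝ≥0∞) ^ k * ENNReal.ofReal ((β - α) * ((c : ℝ) * R k ^ (1 - 2 * ρ))) :=
          mul_le_mul' le_rfl (hball k)
      _ = ENNReal.ofReal (M * θ ^ k + 0 * (0 : ℝ) ^ k) := by
          rw [zero_mul, add_zero, hRk, hM, hθ, mul_pow]
          rw [show (8⁻¹ : ℝ≥0∞) = ENNReal.ofReal 8⁻¹ by
            rw [ENNReal.ofReal_inv_of_pos (by norm_num)]; norm_num, show (8 : ℝ≥0∞) = ENNReal.ofReal 8 by norm_num,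
            ← ENNReal.ofReal_pow (by norm_num), ← ENNReal.ofReal_mul (by norm_num), ← ENNReal.ofReal_mul (by positivity)]
          congr 1
          ring
  refine lt_of_le_of_lt (ENNReal.tsum_le_tsum hterm) ?_
  exact tsum_ofReal_geometric_two_lt_top hM0 le_rfl hθ0 hθ1 le_rfl zero_lt_one

/-- **The tidal weight is integrable against `|p|` on every finite past window** (`α < β ≤ 0`, any `ρ ≥ 0`): with `a₀ = max(1, √(−α))`
and `R_k = a₀2^{k+1}`, `∫∫_{(α,β)×ℝ³} |p|(1+|x|)^{-3} ≤ Σ_k 8·8^{-k} (c R_k^{2−2ρ})^{2/3} ((β−α)|B₁| R_k³)^{1/3} < ∞`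
(ratio `2^{−(2+4ρ)/3} < 1`). [folklore] -/
theorem lintegral_pressure_weight3_lt_top {ρ : ℝ} (hρ : 0 ≤ ρ) {c : ℝ≥0}
    (hpm : AEStronglyMeasurable (uncurry p) (volume.restrict (Iio (0 : ℝ) ×ˢ (univ : Set (EuclideanSpace ℝ (Fin 3))))))
    (hD : ∀ a : ℝ, 0 < a → ENNReal.ofReal (a ^ (2 * ρ)) * cknD a (0 : ℝ × EuclideanSpace ℝ (Fin 3)) p ≤ (c : ℝ≥0∞))
    {α β : ℝ} (hαβ : α < β) (hβ : β ≤ 0) :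
    ∫⁻ z in Ioo α β ×ˢ (univ : Set (EuclideanSpace ℝ (Fin 3))),
        ‖p z.1 z.2‖ₑ * ENNReal.ofReal (((1 + ‖z.2‖) ^ 3)⁻¹) < ⊤ := by
  have hα0 : 0 ≤ -α := by linarith
  set a₀ : ℝ := max 1 (Real.sqrt (-α)) with ha₀
  have ha₀1 : 1 ≤ a₀ := le_max_left _ _
  have ha₀0 : 0 < a₀ := lt_of_lt_of_le one_pos ha₀1
  have ha₀α : -(a₀ ^ 2) ≤ α := by
    have h1 : Real.sqrt (-α) ≤ a₀ := le_max_right _ _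
    have h2 : Real.sqrt (-α) ^ 2 = -α := Real.sq_sqrt hα0
    nlinarith [Real.sqrt_nonneg (-α)]
  set R : ℕ → ℝ := fun k => a₀ * 2 ^ (k + 1) with hR
  have hR0 : ∀ k, 0 < R k := fun k => by positivity
  have hRα : ∀ k, -(R k ^ 2) ≤ α := fun k => by
    have : a₀ ^ 2 ≤ R k ^ 2 := by
      have h1 : a₀ ≤ R k := le_mul_of_one_le_right ha₀0.le (one_le_pow₀ (by norm_num))
      nlinarith
    linarith
  have hWs : Ioo α β ⊆ Iio (0 : ℝ) := fun s hs => lt_of_lt_of_le hs.2 hβ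
  have hF : AEMeasurable (fun z : ℝ × EuclideanSpace ℝ (Fin 3) => ‖p z.1 z.2‖ₑ)
      (volume.restrict (Ioo α β ×ˢ (univ : Set (EuclideanSpace ℝ (Fin 3))))) :=
    (hpm.mono_measure (Measure.restrict_mono (prod_mono hWs Subset.rfl) le_rfl)).aemeasurable.enorm
  refine lt_of_le_of_lt (lintegral_weight3_le_tsum hF ha₀1) ?_
  -- volume of the window × ball
  set V : ℝ := (volume (ball (0 : EuclideanSpace ℝ (Fin 3)) 1)).toReal with hV
  have hV0 : 0 ≤ V := ENNReal.toReal_nonneg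
  have hvol : ∀ k : ℕ, volume (Ioo α β ×ˢ ball (0 : EuclideanSpace ℝ (Fin 3)) (R k)) =
      ENNReal.ofReal ((β - α) * (R k ^ 3 * V)) := by
    intro k
    rw [Measure.volume_eq_prod, Measure.prod_prod, Real.volume_Ioo, Measure.addHaar_ball volume _ (hR0 k).le,
      finrank_euclideanSpace_fin, hV, ENNReal.ofReal_mul (by linarith), ENNReal.ofReal_mul (by positivity),
      ENNReal.ofReal_toReal measure_ball_lt_top.ne]
  have hball : ∀ k : ℕ, ∫⁻ z in Ioo α β ×ˢ ball (0 : EuclideanSpace ℝ (Fin 3)) (a₀ * (2 : ℝ) ^ (k + 1)), ‖p z.1 z.2‖ₑ ≤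
      ENNReal.ofReal (((c : ℝ) * R k ^ (2 - 2 * ρ)) ^ (2 / 3 : ℝ) * ((β - α) * (R k ^ 3 * V)) ^ (1 / 3 : ℝ)) := by
    intro k
    have h := lintegral_pressure_window_ball_le_of_gaugeD hpm hD (hR0 k) (hRα k) hβ (α := α) (β := β)
    rw [hvol k, ENNReal.ofReal_rpow_of_nonneg (by positivity) (by norm_num),
      ENNReal.ofReal_rpow_of_nonneg (by positivity) (by norm_num), ← ENNReal.ofReal_mul (by positivity)] at h
    exact h
  -- the geometric series, exponent `s = (2-2ρ)·(2/3) + 1 = (7 - 4ρ)/3`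
  set s : ℝ := (7 - 4 * ρ) / 3 with hs
  set M : ℝ := 8 * (((c : ℝ)) ^ (2 / 3 : ℝ) * ((β - α) * V) ^ (1 / 3 : ℝ) * (2 * a₀) ^ s) with hM
  have hM0 : 0 ≤ M := by positivity
  set θ : ℝ := 8⁻¹ * (2 : ℝ) ^ s with hθ
  have hθ0 : 0 ≤ θ := by positivity
  have hθ1 : θ < 1 := by
    have h2 : (2 : ℝ) ^ s ≤ 2 ^ ((7 : ℝ) / 3) := Real.rpow_le_rpow_of_exponent_le one_le_two (by rw [hs]; linarith)
    have h3 : (2 : ℝ) ^ ((7 : ℝ) / 3) < 8 := by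
      have : (2 : ℝ) ^ ((7 : ℝ) / 3) < 2 ^ (3 : ℝ) := Real.rpow_lt_rpow_of_exponent_lt one_lt_two (by norm_num)
      have h8 : (2 : ℝ) ^ (3 : ℝ) = 8 := by norm_num
      linarith
    rw [hθ]; nlinarith
  have hterm : ∀ k : ℕ, (8 : ℝ≥0∞) * (8⁻¹ : ℝ≥0∞) ^ k *
      ∫⁻ z in Ioo α β ×ˢ ball (0 : EuclideanSpace ℝ (Fin 3)) (a₀ * (2 : ℝ) ^ (k + 1)), ‖p z.1 z.2‖ₑ ≤
      ENNReal.ofReal (M * θ ^ k + 0 * (0 : ℝ) ^ k) := by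
    intro k
    have hRk : ∀ e : ℝ, R k ^ e = (2 * a₀) ^ e * ((2 : ℝ) ^ e) ^ k := by
      intro e
      simp only [hR]
      rw [pow_succ, show a₀ * (2 ^ k * 2) = (2 * a₀) * 2 ^ k by ring,
        Real.mul_rpow (by positivity) (by positivity), ← Real.rpow_natCast (2 : ℝ) k, ← Real.rpow_mul (by norm_num),
        mul_comm (k : ℝ), Real.rpow_mul (by norm_num), Real.rpow_natCast]
    have key : ∀ r : ℝ, 0 < r → ((c : ℝ) * r ^ (2 - 2 * ρ)) ^ (2 / 3 : ℝ) * ((β - α) * (r ^ 3 * V)) ^ (1 / 3 : ℝ) =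
        (c : ℝ) ^ (2 / 3 : ℝ) * ((β - α) * V) ^ (1 / 3 : ℝ) * r ^ s := by
      intro r hr
      have h3 : r ^ 3 = r ^ (3 : ℝ) := by rw [← Real.rpow_natCast]; norm_num
      rw [Real.mul_rpow NNReal.zero_le_coe (Real.rpow_nonneg hr.le _), ← Real.rpow_mul hr.le,
        show (β - α) * (r ^ 3 * V) = ((β - α) * V) * r ^ 3 by ring,
        Real.mul_rpow (by positivity) (by positivity), h3, ← Real.rpow_mul hr.le]
      have hsum : r ^ ((2 - 2 * ρ) * (2 / 3 : ℝ)) * r ^ ((3 : ℝ) * (1 / 3)) = r ^ s := by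
        rw [← Real.rpow_add hr]; congr 1; rw [hs]; ring
      calc (c : ℝ) ^ (2 / 3 : ℝ) * r ^ ((2 - 2 * ρ) * (2 / 3 : ℝ)) * (((β - α) * V) ^ (1 / 3 : ℝ) * r ^ ((3 : ℝ) * (1 / 3)))
          = (c : ℝ) ^ (2 / 3 : ℝ) * ((β - α) * V) ^ (1 / 3 : ℝ) * (r ^ ((2 - 2 * ρ) * (2 / 3 : ℝ)) * r ^ ((3 : ℝ) * (1 / 3))) := by
            ring
        _ = (c : ℝ) ^ (2 / 3 : ℝ) * ((β - α) * V) ^ (1 / 3 : ℝ) * r ^ s := by rw [hsum]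
    have hprod : ((c : ℝ) * R k ^ (2 - 2 * ρ)) ^ (2 / 3 : ℝ) * ((β - α) * (R k ^ 3 * V)) ^ (1 / 3 : ℝ) =
        (c : ℝ) ^ (2 / 3 : ℝ) * ((β - α) * V) ^ (1 / 3 : ℝ) * (2 * a₀) ^ s * ((2 : ℝ) ^ s) ^ k := by
      rw [key (R k) (hR0 k), hRk s]; ring
    calc (8 : ℝ≥0∞) * (8⁻¹ : ℝ≥0∞) ^ k *
          ∫⁻ z in Ioo α β ×ˢ ball (0 : EuclideanSpace ℝ (Fin 3)) (a₀ * (2 : ℝ) ^ (k + 1)), ‖p z.1 z.2‖ₑ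
        ≤ (8 : ℝ≥0∞) * (8⁻¹ : ℝ≥0∞) ^ k *
            ENNReal.ofReal (((c : ℝ) * R k ^ (2 - 2 * ρ)) ^ (2 / 3 : ℝ) * ((β - α) * (R k ^ 3 * V)) ^ (1 / 3 : ℝ)) :=
          mul_le_mul' le_rfl (hball k)
      _ = ENNReal.ofReal (M * θ ^ k + 0 * (0 : ℝ) ^ k) := by
          rw [zero_mul, add_zero, hprod, hM, hθ, mul_pow]
          rw [show (8⁻¹ : ℝ≥0∞) = ENNReal.ofReal 8⁻¹ by
            rw [ENNReal.ofReal_inv_of_pos (by norm_num)]; norm_num, show (8 : ℝ≥0∞) = ENNReal.ofReal 8 by norm_num,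
            ← ENNReal.ofReal_pow (by norm_num), ← ENNReal.ofReal_mul (by norm_num), ← ENNReal.ofReal_mul (by positivity)]
          congr 1
          ring
  refine lt_of_le_of_lt (ENNReal.tsum_le_tsum hterm) ?_
  exact tsum_ofReal_geometric_two_lt_top hM0 le_rfl hθ0 hθ1 le_rfl zero_lt_one

end Summit.NavierStokesRegularity.NavierStokesRegularity.Theorems.PowerGaugeEulerLiouville.PressureFloor

end
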